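import Summits.ResolutionOfSingularities.ResolutionOfSingularities.Theses.RuledResidues

/-!
# `RuledResidues.NonRuledDivisors` — line `automorphism-orbit`, stub `stub_contractingInjective`

Registered stub of `Cruxes/NonRuledDivisors/Lines/automorphism_orbit.lean` (crux stmt-ResolutionOfSingularities-18075),
proved verbatim (signature = the registered one).  Engine (A): a contraction `τ P ⊆ P²`, `P ≠ 0`, makes the orbit `n ↦ W.comap τⁿ` of every DVR dominating `P` injective.
-/

-- dupNamespace: the problem namespace legitimately repeats the summit name
set_option linter.dupNamespace false

namespace Summit.ResolutionOfSingularities.ResolutionOfSingularities.Theorems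

/-- Engine A of line `automorphism-orbit` (crux `RuledResidues.NonRuledDivisors`): no discrete valuation ring dominating `P ≠ 0` is periodic under a ring automorphism contracting `P` into `P²`. [folklore] -/
theorem stub_contractingInjective : ∀ (K : Type) [Field K] (S : Subring K) (P : Ideal S), P ≠ ⊥ → ∀ (τ : K ≃+* K), (∀ r : K, r ∈ S → τ r ∈ S) → (∀ r : S, r ∈ P → ∃ r' : S, r' ∈ P ^ 2 ∧ (r' : K) = τ (r : K)) → ∀ W : ValuationSubring K, IsDiscreteValuationRing W → S ≤ W.toSubring → (∀ r : S, r ∈ P → (r : K) ∈ W.nonunits) → Function.Injective (fun n : ℕ => W.comap ((τ ^ n : K ≃+* K) : K →+* K)) := by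
  intro K _ S P hP τ _ hcon W hdvr hle hdom
  haveI : IsPrincipalIdealRing W := hdvr.toIsPrincipalIdealRing
  -- the inclusion `S →+* W`
  let ι : S →+* W :=
    { toFun := fun r => ⟨(r : K), hle r.2⟩
      map_one' := rfl
      map_mul' := fun _ _ => rfl
      map_zero' := rfl
      map_add' := fun _ _ => rfl }
  -- `P` lands in the maximal ideal of `W`
  have hPm : ∀ r : S, r ∈ P → ι r ∈ IsLocalRing.maximalIdeal W := fun r hr =>
    ValuationSubring.coe_mem_nonunits_iff.mp (hdom r hr)
  -- iterating the contraction: `τ ^ d` maps `P` into `P ^ 2` for every `d ≥ 1`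
  have hiter : ∀ d : ℕ, 0 < d → ∀ r : S, r ∈ P →
      ∃ r' : S, r' ∈ P ^ 2 ∧ (r' : K) = (τ ^ d) (r : K) := by
    intro d
    induction d with
    | zero => intro h; exact absurd h (lt_irrefl 0)
    | succ d ih =>
      intro _ r hr
      obtain ⟨r', hr'P, hr'⟩ := hcon r hr
      rcases Nat.eq_zero_or_pos d with hd | hd
      · subst hd
        exact ⟨r', hr'P, hr'⟩
      · obtain ⟨r'', hr''P, hr''⟩ := ih hd r' (Ideal.pow_le_self two_ne_zero hr'P)
        refine ⟨r'', hr''P, ?_⟩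
        rw [hr'']
        show (τ ^ d) (r' : K) = (τ ^ d) (τ (r : K))
        rw [hr']
  -- no member of the orbit with positive index equals `W`
  have hkey : ∀ d : ℕ, 0 < d → W.comap ((τ ^ d : K ≃+* K) : K →+* K) ≠ W := by
    intro d hd heq
    have hmem : ∀ z : K, (τ ^ d) z ∈ W ↔ z ∈ W := by
      intro z
      have h1 : z ∈ W.comap ((τ ^ d : K ≃+* K) : K →+* K) ↔ ((τ ^ d : K ≃+* K) : K →+* K) z ∈ W :=
        ValuationSubring.mem_comap
      rw [heq] at h1
      exact h1.symm
    -- the restriction of `(τ ^ d)⁻¹` to a ring endomorphism of `W`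
    let φ : W →+* W :=
      { toFun := fun w => ⟨(τ ^ d).symm (w : K),
          (hmem _).mp (by rw [RingEquiv.apply_symm_apply]; exact w.2)⟩
        map_one' := Subtype.ext (map_one (τ ^ d).symm)
        map_mul' := fun x y => Subtype.ext (map_mul (τ ^ d).symm (x : K) (y : K))
        map_zero' := Subtype.ext (map_zero (τ ^ d).symm)
        map_add' := fun x y => Subtype.ext (map_add (τ ^ d).symm (x : K) (y : K)) }
    have hφK : ∀ w : W, ((φ w : W) : K) = (τ ^ d).symm (w : K) := fun _ => rfl
    -- `φ` preserves the maximal ideal, hence all of its powers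
    have hφm : IsLocalRing.maximalIdeal W ≤ (IsLocalRing.maximalIdeal W).comap φ := by
      intro a ha
      rw [Ideal.mem_comap, ← ValuationSubring.coe_mem_nonunits_iff, hφK,
        ValuationSubring.mem_nonunits_iff_or]
      rw [← ValuationSubring.coe_mem_nonunits_iff, ValuationSubring.mem_nonunits_iff_or] at ha
      rcases ha with h0 | hinv
      · left
        rw [h0, map_zero]
      · right
        intro hW
        apply hinv
        rw [← map_inv₀, ← hmem, RingEquiv.apply_symm_apply] at hW
        exact hW
    have hφpow : ∀ j : ℕ,
        IsLocalRing.maximalIdeal W ^ j ≤ (IsLocalRing.maximalIdeal W ^ j).comap φ :=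
      fun j => (Ideal.pow_right_mono hφm j).trans (Ideal.le_comap_pow φ j)
    -- every element of `P` lies in every power of the maximal ideal of `W`
    have hclaim : ∀ j : ℕ, ∀ r : S, r ∈ P → ι r ∈ IsLocalRing.maximalIdeal W ^ j := by
      intro j
      induction j with
      | zero =>
        intro r _
        rw [pow_zero, Ideal.one_eq_top]
        exact Submodule.mem_top
      | succ j ih =>
        intro r hr
        rcases Nat.eq_zero_or_pos j with hj | hj
        · subst hj
          simpa using hPm r hr
        · obtain ⟨r', hr'P, hr'⟩ := hiter d hd r hr
          have h0 : ι r' ∈ (IsLocalRing.maximalIdeal W ^ j) ^ 2 :=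
            Ideal.mem_comap.mp (Ideal.le_comap_pow ι 2 (Ideal.pow_right_mono
              (show P ≤ (IsLocalRing.maximalIdeal W ^ j).comap ι from fun s hs => ih s hs) 2 hr'P))
          rw [← pow_mul] at h0
          have h1 : ι r' ∈ IsLocalRing.maximalIdeal W ^ (j + 1) :=
            Ideal.pow_le_pow_right (by omega) h0
          have h2 : φ (ι r') = ι r := by
            apply Subtype.ext
            rw [hφK]
            show (τ ^ d).symm (r' : K) = (r : K)
            rw [hr', RingEquiv.symm_apply_apply]
          rw [← h2]
          exact hφpow _ h1
    -- contradiction with Krull's intersection theorem in the noetherian local ring `W`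
    obtain ⟨r, hrP, hr0⟩ := (Submodule.ne_bot_iff P).mp hP
    have hinf : ι r ∈ ⨅ j : ℕ, IsLocalRing.maximalIdeal W ^ j :=
      Ideal.mem_iInf.mpr fun j => hclaim j r hrP
    rw [Ideal.iInf_pow_eq_bot_of_isLocalRing _ (IsLocalRing.maximalIdeal.isMaximal W).ne_top,
      Ideal.mem_bot] at hinf
    apply hr0
    have h3 : (r : K) = 0 := congrArg Subtype.val hinf
    exact Subtype.ext h3
  -- two members with indices `m < n` differ
  -- adapted from `Cruxes/NonRuledDivisors/Lines/automorphism_orbit_modulusInjective.lean`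
  have hlt : ∀ m n : ℕ, m < n →
      W.comap ((τ ^ m : K ≃+* K) : K →+* K) = W.comap ((τ ^ n : K ≃+* K) : K →+* K) → False := by
    intro m n hmn heq
    apply hkey (n - m) (Nat.sub_pos_of_lt hmn)
    ext z
    rw [ValuationSubring.mem_comap]
    have h := congrArg (fun A : ValuationSubring K => (τ ^ m).symm z ∈ A) heq
    simp only [ValuationSubring.mem_comap, eq_iff_iff] at h
    have hpow : τ ^ n = τ ^ (n - m) * τ ^ m := (pow_sub_mul_pow τ hmn.le).symm
    have h2 : ((τ ^ n : K ≃+* K) : K →+* K) ((τ ^ m).symm z) = (τ ^ (n - m)) z := by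
      rw [hpow]
      show (τ ^ (n - m)) ((τ ^ m) ((τ ^ m).symm z)) = _
      rw [RingEquiv.apply_symm_apply]
    have h3 : ((τ ^ m : K ≃+* K) : K →+* K) ((τ ^ m).symm z) = z := by
      show (τ ^ m) ((τ ^ m).symm z) = z
      rw [RingEquiv.apply_symm_apply]
    rw [h2, h3] at h
    exact h.symm
  intro m n hmn
  rcases Nat.lt_trichotomy m n with h | h | h
  · exact (hlt m n h hmn).elim
  · exact h
  · exact (hlt n m h hmn.symm).elim

end Summit.ResolutionOfSingularities.ResolutionOfSingularities.Theorems
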